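import Mathlib
import Summits.KontsevichZagierPeriods.KontsevichZagierPeriods.Theorems.SoloInformedKummerTorsionFourKernel
import Summits.KontsevichZagierPeriods.KontsevichZagierPeriods.Theorems.SoloInformedKummerZetaBand
import HarnessLib
import HarnessLib.Audit

/-!
# Abel's theorem for the third kind inside `P`, I — Pell–Abel data and the 2-form (s41)

THEOREM XXX of the residency paper (§6quindecies), file I of three.  A **Pell–Abel datum** for the
Kummer family `Π(n | m) = ∫₀¹ dt/((1−nt²)√((1−t²)(1−mt²)))` is a solution `(A, B)` of the twisted
Pell–Abel equation over `ℚ̄[t]`,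

  `A² − B²·Δ = R·(1 − nt²)`,  `Δ = (1−t²)(1−mt²)`,  `R > 0` and `A > 0` on `[−1,1]`, `B(0) = 0`,

together with the logarithmic derivative of the unit `h = (A + B√Δ)/(A − B√Δ)` in lowest terms,
`2(AB′ − A′B)Δ + ABΔ′ = (q₀ + q₂t²)·R` (so `dlog h = (q₀ + q₂t²)κ dt/(1−nt²)`), and the residue
condition `q₂ + nq₀ ≠ 0`.  Such data exist exactly on the hyperbolic torsion fibres of the family
(Abel 1826); files `SoloInformedKummerTorsionFour` (order 4) and `SoloInformedKummerTorsionThree`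
(order 3) construct them along rational curves.  THEOREM XXX (file III, `soloInformed_pellAbel_law`):
for every Pell–Abel datum, `⟦Π(n | m)⟧ = (q₂/(q₂ + nq₀))·⟦K(m)⟧` in `P`, for all representations.

This file: with `X = BW`, `W = Δκ` (`= √Δ` on `t² < 1`), `v = 2u − 1`, the algebraic 2-form
`ψ = (q₀+q₂t²)Rκ/(A + vX)²` on `(0,1)²`, its KILL potential `φ = 2X/(A + vX)` (`∂_t φ = ψ`,
`φ(0,u) = φ(1,u) = 0`) and its DEFORMATION potential `Φ = u(q₀+q₂t²)Rκ/((A − X)(A + vX))`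
(`∂_u Φ = ψ`, `Φ(t,0) = 0`, `Φ(t,1) = (q₀+q₂t²)κ/(1−nt²) =: G` by the norm identity); positivity of
the denominators (`X² = A² − R(1−nt²) < A²`), fibrewise continuity, and the dominations
`|ψ| ≤ C(√(1−t))⁻¹`, `|G| ≤ C′(√(1−t))⁻¹` (constants by compactness).

References: N. H. Abel, *Sur l'intégration de la formule différentielle ρdx/√R, R et ρ étant des
fonctions entières* (1826); M. Kontsevich, D. Zagier, *Periods* (2001), §1.2; this work.
-/

noncomputable section

open MeasureTheory Set Filter
open scoped Classical

open Literature.NumberTheory.Transcendental Literature.NumberTheory.Transcendental.KZ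
open Literature.ModelTheory.ExponentialFields

namespace Summit.KontsevichZagierPeriods.KontsevichZagierPeriods.Theorems

/-- A **Pell–Abel datum** for the Kummer family: moduli `m, n ∈ (0,1)`, the unit `A + B√Δ` with
`A² − B²Δ = R(1−nt²)`, its logarithmic derivative `(q₀ + q₂t²)R`, positivity, the residue
condition, and the (semi)algebraicity of all coefficients. [Abel 1826; this work] -/
structure SoloInformedPellAbel where
  /-- the modulus `m` -/
  m : ℝ
  /-- the parameter `n` of the third kind -/
  n : ℝ
  /-- constant coefficient of the residue polynomial `q` -/
  q₀ : ℝ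
  /-- quadratic coefficient of the residue polynomial `q` -/
  q₂ : ℝ
  /-- the polynomial `A` -/
  A : ℝ → ℝ
  /-- its derivative -/
  A' : ℝ → ℝ
  /-- the polynomial `B` -/
  B : ℝ → ℝ
  /-- its derivative -/
  B' : ℝ → ℝ
  /-- the cofactor `R` of the norm -/
  R : ℝ → ℝ
  m_mem : m ∈ Ioo (0:ℝ) 1
  n_mem : n ∈ Ioo (0:ℝ) 1
  m_isAlgebraic : IsAlgebraic ℚ m
  n_isAlgebraic : IsAlgebraic ℚ n
  q₀_isAlgebraic : IsAlgebraic ℚ q₀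
  q₂_isAlgebraic : IsAlgebraic ℚ q₂
  hasDerivAt_A : ∀ t, HasDerivAt A (A' t) t
  hasDerivAt_B : ∀ t, HasDerivAt B (B' t) t
  continuous_R : Continuous R
  norm : ∀ t, A t ^ 2 - B t ^ 2 * ((1 - t ^ 2) * (1 - m * t ^ 2)) = R t * (1 - n * t ^ 2)
  num : ∀ t, 2 * (A t * B' t - A' t * B t) * ((1 - t ^ 2) * (1 - m * t ^ 2)) +
      A t * B t * (-(2 * t) * (1 - m * t ^ 2) + (1 - t ^ 2) * (-(m * (2 * t)))) =
    (q₀ + q₂ * t ^ 2) * R t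
  A_pos : ∀ t, t ^ 2 ≤ 1 → 0 < A t
  R_pos : ∀ t, t ^ 2 ≤ 1 → 0 < R t
  B_zero : B 0 = 0
  res : q₂ + n * q₀ ≠ 0
  sa_A : ∀ ⦃S : Set (Fin 2 → ℝ)⦄, IsSemialgebraic ℚ S → ∀ i : Fin 2,
    IsSemialgebraicFunOn ℚ S (fun w => A (w i))
  sa_B : ∀ ⦃S : Set (Fin 2 → ℝ)⦄, IsSemialgebraic ℚ S → ∀ i : Fin 2,
    IsSemialgebraicFunOn ℚ S (fun w => B (w i))
  sa_R : ∀ ⦃S : Set (Fin 2 → ℝ)⦄, IsSemialgebraic ℚ S → ∀ i : Fin 2,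
    IsSemialgebraicFunOn ℚ S (fun w => R (w i))

namespace SoloInformedPellAbel

variable (P : SoloInformedPellAbel)

/-! ### The 2-form, its two potentials, the deformed end, the law's constants -/

/-- The 2-form density `ψ(t,u) = (q₀+q₂t²)Rκ/(A + (2u−1)BW)²`. [this work] -/
def psi (t u : ℝ) : ℝ :=
  (P.q₀ + P.q₂ * t ^ 2) * P.R t * ((√(1 - t ^ 2))⁻¹ * (√(1 - P.m * t ^ 2))⁻¹) /
    (P.A t + (2 * u - 1) * (P.B t * soloInformedT4W P.m t)) ^ 2

/-- The kill potential `φ(t,u) = 2BW/(A + (2u−1)BW)` (`∂_t φ = ψ`). [this work] -/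
def phi (t u : ℝ) : ℝ :=
  2 * (P.B t * soloInformedT4W P.m t) / (P.A t + (2 * u - 1) * (P.B t * soloInformedT4W P.m t))

/-- The deformation potential `Φ(t,u) = u(q₀+q₂t²)Rκ/((A − BW)(A + (2u−1)BW))` (`∂_u Φ = ψ`).
[this work] -/
def Phi (t u : ℝ) : ℝ :=
  u * ((P.q₀ + P.q₂ * t ^ 2) * P.R t * ((√(1 - t ^ 2))⁻¹ * (√(1 - P.m * t ^ 2))⁻¹)) /
    ((P.A t - P.B t * soloInformedT4W P.m t) *
      (P.A t + (2 * u - 1) * (P.B t * soloInformedT4W P.m t)))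

/-- The deformed end `G(t) = (q₀+q₂t²)κ/(1−nt²)` (`= dlog h/dt = Φ(t,1)`). [this work] -/
def G (t : ℝ) : ℝ :=
  (P.q₀ + P.q₂ * t ^ 2) * ((√(1 - t ^ 2))⁻¹ * (√(1 - P.m * t ^ 2))⁻¹) / (1 - P.n * t ^ 2)

/-- The constant `α = q₂/(q₂ + nq₀)` of the law `⟦Π_n⟧ = α⟦K⟧`. [this work] -/
def alpha : ℝ := P.q₂ / (P.q₂ + P.n * P.q₀)

/-- The constant `β = n/(q₂ + nq₀)` of the split `κ/(1−nt²) = ακ + βG`. [this work] -/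
def beta : ℝ := P.n / (P.q₂ + P.n * P.q₀)

/-- **The split** `α = (1 − βq(t))(1 − nt²)⁻¹`, i.e. `κ/(1−nt²) = ακ + βG`. [this work] -/
theorem alpha_eq {t : ℝ} (h : 1 - P.n * t ^ 2 ≠ 0) :
    P.alpha = (1 - P.beta * (P.q₀ + P.q₂ * t ^ 2)) * (1 - P.n * t ^ 2)⁻¹ := by
  have hr := P.res
  unfold alpha beta
  field_simp
  ring

/-! ### The denominators `A + v·BW`, `|v| ≤ 1` -/

/-- `W(m, t) = 0` when `t² = 1`. [folklore] -/
theorem W_eq_zero_of_sq {m t : ℝ} (ht : t ^ 2 = 1) : soloInformedT4W m t = 0 := by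
  have h : 1 - t ^ 2 = 0 := by linarith
  simp [soloInformedT4W, h]

/-- `(BW)² < A²` for `t² < 1`: `(BW)² = B²Δ = A² − R(1−nt²)`. [this work] -/
theorem sq_X_lt {t : ℝ} (ht : t ^ 2 < 1) : (P.B t * soloInformedT4W P.m t) ^ 2 < P.A t ^ 2 := by
  have hW := soloInformed_t4_W_sq P.m_mem ht
  have hN := P.norm t
  have h1 : 0 < P.R t := P.R_pos t ht.le
  have h2 : 0 < 1 - P.n * t ^ 2 := by nlinarith [P.n_mem.1, P.n_mem.2]
  have h3 := mul_pos h1 h2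
  rw [mul_pow, hW]
  linarith

/-- **The denominators are positive**: `0 < A + v·BW` for `t² < 1`, `|v| ≤ 1`. [this work] -/
theorem denom_pos {t v : ℝ} (ht : t ^ 2 < 1) (hv : v ∈ Icc (-1:ℝ) 1) :
    0 < P.A t + v * (P.B t * soloInformedT4W P.m t) := by
  have hA := P.A_pos t ht.le
  have hX := abs_lt_of_sq_lt_sq' (P.sq_X_lt ht) hA.le
  have h1 : |v * (P.B t * soloInformedT4W P.m t)| ≤ |P.B t * soloInformedT4W P.m t| := by
    rw [abs_mul]
    exact mul_le_of_le_one_left (abs_nonneg _) (abs_le.2 ⟨hv.1, hv.2⟩)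
  have h2 : |P.B t * soloInformedT4W P.m t| < P.A t := abs_lt.2 ⟨hX.1, hX.2⟩
  linarith [neg_abs_le (v * (P.B t * soloInformedT4W P.m t))]

/-- The denominators are positive on the closed fibre `t² ≤ 1` (`W = 0` on `t² = 1`). [this work] -/
theorem denom_pos' {t v : ℝ} (ht : t ^ 2 ≤ 1) (hv : v ∈ Icc (-1:ℝ) 1) :
    0 < P.A t + v * (P.B t * soloInformedT4W P.m t) := by
  rcases ht.eq_or_lt with h | h
  · rw [W_eq_zero_of_sq h, mul_zero, mul_zero, add_zero]
    exact P.A_pos t ht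
  · exact P.denom_pos h hv

/-- `0 < A − BW` for `t² ≤ 1`. [this work] -/
theorem conj_pos {t : ℝ} (ht : t ^ 2 ≤ 1) : 0 < P.A t - P.B t * soloInformedT4W P.m t := by
  have h := P.denom_pos' ht (v := -1) ⟨le_rfl, by norm_num⟩
  linarith

/-! ### The two derivative identities -/

/-- **`∂_t φ = ψ`** for `t² < 1`, `u ∈ [0,1]`: the logarithmic derivative of the unit. [this work] -/
theorem phi_hasDerivAt {t u : ℝ} (ht : t ^ 2 < 1) (hu : u ∈ Icc (0:ℝ) 1) :
    HasDerivAt (fun t => P.phi t u) (P.psi t u) t := by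
  have hv : (2 * u - 1) ∈ Icc (-1:ℝ) 1 := ⟨by linarith [hu.1], by linarith [hu.2]⟩
  have hD := P.denom_pos ht hv
  have hX := (P.hasDerivAt_B t).mul (soloInformed_t4_W_hasDerivAt P.m_mem ht)
  have hφ := (hX.const_mul 2).div ((P.hasDerivAt_A t).add (hX.const_mul (2 * u - 1))) hD.ne'
  have key := P.num t
  unfold phi psi
  refine hφ.congr_deriv ?_
  simp only [Pi.add_apply, Pi.mul_apply]
  rw [div_left_inj' (pow_ne_zero 2 hD.ne')]
  unfold soloInformedT4W
  linear_combination ((√(1 - t ^ 2))⁻¹ * (√(1 - P.m * t ^ 2))⁻¹) * key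

/-- **`∂_u Φ = ψ`** for `t² < 1`, `u ∈ [0,1]`. [this work] -/
theorem Phi_hasDerivAt {t u : ℝ} (ht : t ^ 2 < 1) (hu : u ∈ Icc (0:ℝ) 1) :
    HasDerivAt (fun u => P.Phi t u) (P.psi t u) u := by
  have hv : (2 * u - 1) ∈ Icc (-1:ℝ) 1 := ⟨by linarith [hu.1], by linarith [hu.2]⟩
  have hD := P.denom_pos ht hv
  have hAm := (P.conj_pos ht.le).ne'
  set A := P.A t with hAdef
  set X := P.B t * soloInformedT4W P.m t with hXdef
  set E := (P.q₀ + P.q₂ * t ^ 2) * P.R t * ((√(1 - t ^ 2))⁻¹ * (√(1 - P.m * t ^ 2))⁻¹) with hE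
  have hd : HasDerivAt (fun u : ℝ => (A - X) * (A + (2 * u - 1) * X)) ((A - X) * (2 * 1 * X)) u :=
    (((((hasDerivAt_id' u).const_mul 2).sub_const 1).mul_const X).const_add A).const_mul (A - X)
  have hc : HasDerivAt (fun u : ℝ => u * E) (1 * E) u := (hasDerivAt_id' u).mul_const E
  have h := hc.div hd (mul_ne_zero hAm hD.ne')
  unfold Phi psi
  rw [← hAdef, ← hXdef, ← hE]
  refine h.congr_deriv ?_
  rw [div_eq_div_iff (pow_ne_zero 2 (mul_ne_zero hAm hD.ne')) (pow_ne_zero 2 hD.ne')]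
  ring

/-! ### Boundary values -/

/-- `φ(0,u) = 0` (`B(0) = 0`). [this work] -/
theorem phi_left (u : ℝ) : P.phi 0 u = 0 := by
  simp [phi, P.B_zero]

/-- `φ(1,u) = 0` (`W(1) = 0`). [this work] -/
theorem phi_right (u : ℝ) : P.phi 1 u = 0 := by
  simp [phi, soloInformed_t4_W_one]

/-- `ψ(1,u) = 0` (junk value `(√0)⁻¹ = 0` on the glued face `t = 1`). [this work] -/
theorem psi_right (u : ℝ) : P.psi 1 u = 0 := by
  simp [psi]

/-- `Φ(t,0) = 0`. [this work] -/
theorem Phi_zero (t : ℝ) : P.Phi t 0 = 0 := by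
  simp [Phi]

/-- **The deformed end** `Φ(t,1) = G(t)` for `t² < 1`: `(A − X)(A + X) = R(1−nt²)`. [this work] -/
theorem Phi_one {t : ℝ} (ht : t ^ 2 < 1) : P.Phi t 1 = P.G t := by
  have hWsq := soloInformed_t4_W_sq P.m_mem ht
  have hN := P.norm t
  have hR : P.R t ≠ 0 := (P.R_pos t ht.le).ne'
  have h1n : 1 - P.n * t ^ 2 ≠ 0 := by nlinarith [P.n_mem.1, P.n_mem.2]
  have hprod : (P.A t - P.B t * soloInformedT4W P.m t) *
      (P.A t + (2 * 1 - 1) * (P.B t * soloInformedT4W P.m t)) = P.R t * (1 - P.n * t ^ 2) := by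
    rw [← hN]; ring_nf; rw [hWsq]; ring
  unfold Phi G
  rw [hprod, one_mul, div_eq_div_iff (mul_ne_zero hR h1n) h1n]
  ring

/-! ### Fibrewise continuity -/

/-- `A` is continuous. [folklore] -/
theorem continuous_A : Continuous P.A :=
  continuous_iff_continuousAt.2 fun t => (P.hasDerivAt_A t).continuousAt

/-- `B` is continuous. [folklore] -/
theorem continuous_B : Continuous P.B :=
  continuous_iff_continuousAt.2 fun t => (P.hasDerivAt_B t).continuousAt

/-- `W(m,·)` is continuous. [folklore] -/
theorem W_continuous (m : ℝ) : Continuous fun t => soloInformedT4W m t := by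
  have h : (fun t => soloInformedT4W m t) = fun t => √(1 - t ^ 2) * √(1 - m * t ^ 2) :=
    funext fun t => soloInformed_t4_W_eq_sqrt m t
  rw [h]
  exact (Real.continuous_sqrt.comp (continuous_const.sub (continuous_pow 2))).mul
    (Real.continuous_sqrt.comp (continuous_const.sub (continuous_const.mul (continuous_pow 2))))

/-- `X = BW` is continuous. [folklore] -/
theorem continuous_X : Continuous fun t => P.B t * soloInformedT4W P.m t :=
  P.continuous_B.mul (W_continuous P.m)

/-- `φ(·,u)` is continuous on `[0,1]` (`u ∈ [0,1]`). [this work] -/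
theorem phi_continuousOn {u : ℝ} (hu : u ∈ Icc (0:ℝ) 1) :
    ContinuousOn (fun t => P.phi t u) (Icc 0 1) := by
  have hv : (2 * u - 1) ∈ Icc (-1:ℝ) 1 := ⟨by linarith [hu.1], by linarith [hu.2]⟩
  have hX := P.continuous_X
  unfold phi
  exact ((continuous_const.mul hX).continuousOn).div
    ((P.continuous_A.add (continuous_const.mul hX)).continuousOn)
    fun t ht => (P.denom_pos' (by nlinarith [ht.1, ht.2]) hv).ne'

/-- `Φ(t,·)` is continuous on `[0,1]` (`t² < 1`). [this work] -/
theorem Phi_continuousOn {t : ℝ} (ht : t ^ 2 < 1) : ContinuousOn (fun u => P.Phi t u) (Icc 0 1) := by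
  have hAm := (P.conj_pos ht.le).ne'
  unfold Phi
  refine ContinuousOn.div (by fun_prop) (by fun_prop) fun u hu => mul_ne_zero hAm ?_
  exact (P.denom_pos ht ⟨by linarith [hu.1], by linarith [hu.2]⟩).ne'

/-! ### Dominations (constants by compactness) -/

/-- A uniform lower bound of the denominators on `t² ≤ 1`, `|v| ≤ 1`. [this work] -/
theorem exists_denom_ge : ∃ d : ℝ, 0 < d ∧ ∀ t : ℝ, t ^ 2 ≤ 1 → ∀ v ∈ Icc (-1:ℝ) 1,
    d ≤ P.A t + v * (P.B t * soloInformedT4W P.m t) := by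
  set f : ℝ × ℝ → ℝ := fun p => P.A p.1 + p.2 * (P.B p.1 * soloInformedT4W P.m p.1) with hf
  have hK : IsCompact (Icc (-1:ℝ) 1 ×ˢ Icc (-1:ℝ) 1) := isCompact_Icc.prod isCompact_Icc
  have hne : (Icc (-1:ℝ) 1 ×ˢ Icc (-1:ℝ) 1).Nonempty :=
    ⟨(0, 0), ⟨⟨by norm_num, by norm_num⟩, ⟨by norm_num, by norm_num⟩⟩⟩
  have hfc : Continuous f :=
    (P.continuous_A.comp continuous_fst).add (continuous_snd.mul (P.continuous_X.comp continuous_fst))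
  obtain ⟨p, hp, hmin⟩ := hK.exists_isMinOn hne hfc.continuousOn
  have hp1 : p.1 ^ 2 ≤ 1 := by
    have h := hp.1
    nlinarith [h.1, h.2, abs_le.2 ⟨h.1, h.2⟩, sq_abs p.1]
  refine ⟨f p, P.denom_pos' hp1 hp.2, fun t ht v hv => ?_⟩
  have htI : t ∈ Icc (-1:ℝ) 1 := by
    have h := abs_le.1 (sq_le_one_iff_abs_le_one t |>.1 ht)
    exact ⟨h.1, h.2⟩
  exact (isMinOn_iff.1 hmin) (t, v) ⟨htI, hv⟩

/-- A uniform bound of the numerator `(q₀+q₂t²)R` on `t² ≤ 1`. [this work] -/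
theorem exists_num_le : ∃ C : ℝ, 0 ≤ C ∧ ∀ t : ℝ, t ^ 2 ≤ 1 → |(P.q₀ + P.q₂ * t ^ 2) * P.R t| ≤ C := by
  have hfc : Continuous fun t : ℝ => (P.q₀ + P.q₂ * t ^ 2) * P.R t :=
    (continuous_const.add (continuous_const.mul (continuous_pow 2))).mul P.continuous_R
  obtain ⟨C, hC⟩ := (isCompact_Icc (a := (-1:ℝ)) (b := 1)).exists_bound_of_continuousOn hfc.continuousOn
  have h0 := hC 0 ⟨by norm_num, by norm_num⟩
  refine ⟨C, (norm_nonneg _).trans h0, fun t ht => ?_⟩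
  have h := abs_le.1 (sq_le_one_iff_abs_le_one t |>.1 ht)
  have h' := hC t ⟨h.1, h.2⟩
  rwa [Real.norm_eq_abs] at h'

/-- **Domination of the 2-form**: `|ψ(t,u)| ≤ C(√(1−t))⁻¹` on `[0,1) × [0,1]`. [this work] -/
theorem exists_psi_abs_le : ∃ C : ℝ, 0 ≤ C ∧ ∀ t ∈ Ico (0:ℝ) 1, ∀ u ∈ Icc (0:ℝ) 1,
    |P.psi t u| ≤ C * (√(1 - t))⁻¹ := by
  obtain ⟨d, hd, hdle⟩ := P.exists_denom_ge
  obtain ⟨C, hC0, hC⟩ := P.exists_num_le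
  have hm := P.m_mem
  refine ⟨C / d ^ 2 * (√(1 - P.m))⁻¹, by positivity, fun t ht u hu => ?_⟩
  have ht2 : t ^ 2 < 1 := by nlinarith [ht.1, ht.2]
  have hv : (2 * u - 1) ∈ Icc (-1:ℝ) 1 := ⟨by linarith [hu.1], by linarith [hu.2]⟩
  have hD := P.denom_pos ht2 hv
  have hDge := hdle t ht2.le _ hv
  have hN := hC t ht2.le
  have hκ := soloInformed_kummerZeta_kappa_le hm ht
  have hκ0 : 0 ≤ (√(1 - t ^ 2))⁻¹ * (√(1 - P.m * t ^ 2))⁻¹ := by positivity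
  have hb0 : 0 ≤ (√(1 - t))⁻¹ * (√(1 - P.m))⁻¹ := by positivity
  set D := P.A t + (2 * u - 1) * (P.B t * soloInformedT4W P.m t) with hDdef
  have hD2 : d ^ 2 ≤ D ^ 2 := pow_le_pow_left₀ hd.le hDge 2
  unfold psi
  rw [← hDdef, abs_div, abs_mul, abs_of_nonneg hκ0, abs_of_pos (pow_pos hD 2)]
  calc |(P.q₀ + P.q₂ * t ^ 2) * P.R t| * ((√(1 - t ^ 2))⁻¹ * (√(1 - P.m * t ^ 2))⁻¹) / D ^ 2
      ≤ C * ((√(1 - t))⁻¹ * (√(1 - P.m))⁻¹) / D ^ 2 :=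
        div_le_div_of_nonneg_right (mul_le_mul hN hκ hκ0 hC0) (pow_pos hD 2).le
    _ ≤ C * ((√(1 - t))⁻¹ * (√(1 - P.m))⁻¹) / d ^ 2 :=
        div_le_div_of_nonneg_left (mul_nonneg hC0 hb0) (pow_pos hd 2) hD2
    _ = C / d ^ 2 * (√(1 - P.m))⁻¹ * (√(1 - t))⁻¹ := by ring

/-- The constant of `|G| ≤ C′(√(1−t))⁻¹`. [this work] -/
def CG : ℝ := (|P.q₀| + |P.q₂|) / (1 - P.n) * (√(1 - P.m))⁻¹

/-- `0 ≤ C′`. [this work] -/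
theorem CG_nonneg : 0 ≤ P.CG := by
  have : 0 < 1 - P.n := by linarith [P.n_mem.2]
  unfold CG
  positivity

/-- **Domination of the deformed end**: `|G(t)| ≤ C′(√(1−t))⁻¹` on `[0,1)`. [this work] -/
theorem G_abs_le {t : ℝ} (ht : t ∈ Ico (0:ℝ) 1) : |P.G t| ≤ P.CG * (√(1 - t))⁻¹ := by
  have hm := P.m_mem
  have hn := P.n_mem
  have ht2 : t ^ 2 < 1 := by nlinarith [ht.1, ht.2]
  have hq : |P.q₀ + P.q₂ * t ^ 2| ≤ |P.q₀| + |P.q₂| := by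
    refine (abs_add_le _ _).trans (add_le_add le_rfl ?_)
    rw [abs_mul, abs_of_nonneg (sq_nonneg t)]
    exact mul_le_of_le_one_right (abs_nonneg _) ht2.le
  have hq0 : 0 ≤ |P.q₀| + |P.q₂| := by positivity
  have hκ := soloInformed_kummerZeta_kappa_le hm ht
  have hκ0 : 0 ≤ (√(1 - t ^ 2))⁻¹ * (√(1 - P.m * t ^ 2))⁻¹ := by positivity
  have hb0 : 0 ≤ (√(1 - t))⁻¹ * (√(1 - P.m))⁻¹ := by positivity
  have h1n : 0 < 1 - P.n := by linarith [hn.2]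
  have hD : 0 < 1 - P.n * t ^ 2 := by nlinarith [hn.1, hn.2]
  have hDge : 1 - P.n ≤ 1 - P.n * t ^ 2 := by nlinarith [hn.1]
  unfold G CG
  rw [abs_div, abs_mul, abs_of_nonneg hκ0, abs_of_pos hD]
  calc |P.q₀ + P.q₂ * t ^ 2| * ((√(1 - t ^ 2))⁻¹ * (√(1 - P.m * t ^ 2))⁻¹) / (1 - P.n * t ^ 2)
      ≤ (|P.q₀| + |P.q₂|) * ((√(1 - t))⁻¹ * (√(1 - P.m))⁻¹) / (1 - P.n * t ^ 2) :=
        div_le_div_of_nonneg_right (mul_le_mul hq hκ hκ0 hq0) hD.le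
    _ ≤ (|P.q₀| + |P.q₂|) * ((√(1 - t))⁻¹ * (√(1 - P.m))⁻¹) / (1 - P.n) :=
        div_le_div_of_nonneg_left (mul_nonneg hq0 hb0) h1n hDge
    _ = _ := by ring

end SoloInformedPellAbel

end Summit.KontsevichZagierPeriods.KontsevichZagierPeriods.Theorems

end
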